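import Literature.Probability.Percolation.SlabRSWGluingLobeCross
import Literature.Probability.Percolation.SlabRSWProp39
import HarnessLib

/-!
# Newman–Tassion–Wu 2017, §3.4 (proof of Theorem 3.10): crossing an L-shaped region from rectangle
# crossings, linear regime

Topic: `Literature/Probability/Percolation`. The first step of the proof of NTW's Theorem 3.10 bounds the
probability of crossing the L-shaped region `S₁ = H-arm ∪ V-arm` from the bottom of the vertical arm to
the right end of the horizontal arm ("`B(S₁) ⟷^{S₁} R(S₁)`") from below by rectangle crossings, "by
performing several gluing procedures similar to those used in the proof of Proposition 3.9" with the
linear bound of Remark 3. Here, with the L-shaped gluing lemma `glue0_linear_lobe`: for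
`S = [a,b]×[c,d]` (the horizontal arm including the corner square), the lobe `V = [a,a']×[c',c-1]` and
the full vertical column `W = [a,a']×[c',d] ⊆ S ∪ V`:
`P_p[L(S) ⟷^S R(S)] · P_p[bottom ⟷^W top] ≤ (1 + λ_p^s) · P_p[bottom of V ⟷^{S ∪ V} R(S)]`.

* `real_LCross_ge` — PROVED.

## Sources

* C. M. Newman, V. Tassion, W. Wu, *Critical percolation and the minimal spanning tree in slabs*,
  Comm. Pure Appl. Math. 70 (2017), arXiv:1512.09107: §3.4, proof of Theorem 3.10 (the regions
  `S₁, S₁′`, (3.65), "P[B(S₁) ⟷ R(S₁)] ≥ h(c)") [NewmanTassionWu2017].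
-/

noncomputable section

namespace Literature.Probability.Percolation

open MeasureTheory LatticeModels SimpleGraph

namespace NTW17

variable {k : ℕ}

/-- **Crossing the L from rectangle crossings (linear regime).** For `k ≥ 1`, `ρ ≥ 2`, integers with
`a + 2ρ + 6 ≤ a'`, `a' + 4ρ + 9 ≤ b`, `c' + 4ρ + 9 ≤ c`, `c + 3 ≤ d`, and `0 < p < 1`:
`P_p[{x=a} ⟷^S {x=b}] · P_p[{y=c'} ⟷^W {y=d}] ≤ (1 + λ_p^s) · P_p[{y=c'} ⟷^{S ∪ V} {x=b}]`, where
`S = [a,b]×[c,d]`, `V = [a,a']×[c',c-1]`, `W = [a,a']×[c',d]`, `λ_p = 2/min(p,1-p)`, `s = 3(5k+4)(4ρ+13)²`.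
[cite: NewmanTassionWu2017, §3.4 (proof of Theorem 3.10: "P[B(S₁) ⟷^{S₁} R(S₁)] ≥ h(c)", (3.65))] -/
theorem real_LCross_ge (hk : 1 ≤ k) {ρ : ℕ} (hρ : 2 ≤ ρ) {a a' b c' c d : ℤ}
    (hwide : a + 2 * ρ + 6 ≤ a') (hab : a' + 4 * ρ + 9 ≤ b) (hc'c : c' + 4 * ρ + 9 ≤ c) (hcd : c + 3 ≤ d)
    (p : unitInterval) (hp0 : 0 < (p : ℝ)) (hp1 : (p : ℝ) < 1) :
    (bondPercolation (slabGraph 3 k) p).real (slabConn k (boxR a b c d) {z | z.1 = a} {z | z.1 = b}) *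
        (bondPercolation (slabGraph 3 k) p).real (slabConn k (boxR a a' c' d) {z | z.2 = c'} {z | z.2 = d}) ≤
      (1 + (2 / min (p : ℝ) (1 - p)) ^ (3 * ((5 * k + 4) * (2 * (2 * (ρ + 3)) + 1) ^ 2))) *
        (bondPercolation (slabGraph 3 k) p).real
          (slabConn k (boxR a b c d ∪ boxR a a' c' (c - 1)) {z | z.2 = c'} {z | z.1 = b}) := by
  set P := bondPercolation (slabGraph 3 k) p with hP
  -- the L-shaped gluing datum: `A` = right side of `S`, `C` = bottom row of the lobe
  let G : LobeSetup :=
    { a := a, b := b, c := c, d := d, a' := a', c' := c'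
      A := {z | z ∈ boxR a b c d ∧ z.1 = b}, C := {z | z.2 = c' ∧ a ≤ z.1 ∧ z.1 ≤ a'}
      hab := by omega, hcd := hcd, haa' := by omega, ha'b := by omega
      hA := fun z hz => hz.1
      hAB := by
        intro z hz
        have h1 : z ∈ boxR a b c d := hz.1
        have h2 : z.1 = b := hz.2
        rw [mem_boxR_iff] at h1; omega
      hC := by
        intro z hz
        simp only [Set.mem_setOf_eq] at hz
        right; rw [mem_boxR_iff]; omega }
  have hglue := glue0_linear_lobe G hk hρ (by show a + 2 * (ρ : ℤ) + 6 ≤ a'; exact hwide)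
    (fun a'' ha'' => by
      have h1 : a'' ∈ boxR a b c d := ha''.1
      have h2 : a''.1 = b := ha''.2
      show a' + 2 * (ρ : ℤ) + 8 ≤ a''.1; omega)
    (fun a'' ha'' cc hcc hmem => by
      have h2 : a''.1 = b := ha''.2
      have h3 : cc.2 = c' ∧ a ≤ cc.1 ∧ cc.1 ≤ a' := hcc
      rw [mem_sqBox_iff'] at hmem; push_cast at hmem; omega)
    (fun cc hcc s' hs' hmem => by
      have h3 : cc.2 = c' ∧ a ≤ cc.1 ∧ cc.1 ≤ a' := hcc
      have hs'' : s' ∈ boxR a b c d := hs'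
      rw [mem_boxR_iff] at hs''
      rw [mem_sqBox_iff'] at hmem; push_cast at hmem; omega)
    (Dd := {z | z.2 = d}) (fun z hz => hz.2) (fun z hz => by
      have h : z.2 = c' ∧ a ≤ z.1 ∧ z.1 ≤ a' := hz
      show z.2 ≤ c - 1; omega) (fun z hz => hz)
    p hp0 hp1
  -- compare the events
  have hS : G.S = boxR a b c d := rfl
  have hR : G.R = boxR a b c d ∪ boxR a a' c' (c - 1) := rfl
  have h1 : P.real (slabConn k (boxR a b c d) {z | z.1 = a} {z | z.1 = b}) ≤ P.real (slabConn k G.S G.A G.B) := by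
    rw [Literature.Probability.Percolation.slabConn_comm]
    refine measureReal_mono (fun ω hω => ?_) (measure_ne_top _ _)
    have hω1 := slabConn_subset_inter_source (slabConn_subset_inter_target hω)
    exact slabConn_mono_sets subset_rfl (fun z hz => show z ∈ G.A from ⟨hz.1, hz.2⟩)
      (fun z hz => show z ∈ G.B from ⟨hz.1, hz.2⟩) hω1
  have h2 : P.real (slabConn k (boxR a a' c' d) {z | z.2 = c'} {z | z.2 = d}) ≤
      P.real (slabConn k G.R G.C {z | z.2 = d}) := by
    refine measureReal_mono (fun ω hω => ?_) (measure_ne_top _ _)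
    have hω1 := slabConn_subset_inter_source hω
    have hsub : boxR a a' c' d ⊆ G.R := by
      intro z hz
      rw [mem_boxR_iff] at hz
      rw [hR, Set.mem_union, mem_boxR_iff, mem_boxR_iff]
      omega
    refine slabConn_mono_sets hsub (fun z hz => ?_) subset_rfl hω1
    have hz1 : z ∈ boxR a a' c' d := hz.1
    rw [mem_boxR_iff] at hz1
    exact ⟨hz.2, hz1.1, hz1.2.1⟩
  have h3 : P.real (slabConn k G.R G.C G.A) ≤
      P.real (slabConn k (boxR a b c d ∪ boxR a a' c' (c - 1)) {z | z.2 = c'} {z | z.1 = b}) := by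
    rw [← hR]
    exact measureReal_mono (slabConn_mono_sets subset_rfl (fun z hz => hz.1) (fun z hz => hz.2))
      (measure_ne_top _ _)
  have hK : 0 ≤ (1 + (2 / min (p : ℝ) (1 - p)) ^ (3 * ((5 * k + 4) * (2 * (2 * (ρ + 3)) + 1) ^ 2))) := by
    positivity
  calc P.real (slabConn k (boxR a b c d) {z | z.1 = a} {z | z.1 = b}) *
        P.real (slabConn k (boxR a a' c' d) {z | z.2 = c'} {z | z.2 = d})
      ≤ P.real (slabConn k G.S G.A G.B) * P.real (slabConn k G.R G.C {z | z.2 = d}) :=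
        mul_le_mul h1 h2 measureReal_nonneg measureReal_nonneg
    _ ≤ _ := hglue
    _ ≤ _ := mul_le_mul_of_nonneg_left h3 hK

end NTW17

end Literature.Probability.Percolation

end
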